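import Summits.BirchSwinnertonDyer.BirchSwinnertonDyer.Theorems.GenusKolyvaginAtTwoGenusPrimitiveSupplyAtTwoTranspositionKummerReading
import Summits.BirchSwinnertonDyer.BirchSwinnertonDyer.Theorems.GenusKolyvaginAtTwoGenusPrimitiveSupplyAtTwoTwistingPrime
import Summits.BirchSwinnertonDyer.BirchSwinnertonDyer.Theorems.GenusKolyvaginAtTwoGenusPrimitiveSupplyAtTwoHeegnerTwinParity
import Summits.BirchSwinnertonDyer.BirchSwinnertonDyer.Theorems.GenusKolyvaginAtTwoGenusPrimitiveSupplyAtTwoTwistSelmerTransferDownRat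
import Summits.BirchSwinnertonDyer.Rank1Residual.F1Sign2.TranspositionSupplyAtTwo
import Literature.NumberTheory.EllipticCurves.SelmerGroupCardinality
import Literature.NumberTheory.EllipticCurves.TwoAdicImageSurjectivityModTwoProofs
import HarnessLib

/-!
# Route `GenusKolyvaginAtTwo`, crux #2 `GenusPrimitiveSupplyAtTwo` (stmt-BirchSwinnertonDyer-22136):
# the cell's AN-24S `F1Sign2.SingleDoor.TranspositionSupplyAtTwo` BY NAME, UNCONDITIONALLY — at `Δ < 0` an admissible Heegner field
# with an OPEN transposition door always exists (Mazur–Rubin twisting primes at `2`, the LEAD's `exists_twistingPrime`, read through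
# the Kummer dictionary of `…TranspositionKummerReading`)

Width seat `bsd-line-gk2-p4` g13 (cell `bsd-f1-sign2`), sequel of `…TranspositionKummerReading` and of the LEAD's `…TwistingPrime`
(gk2-p1 g4–g5: MAZUR–RUBIN TWISTING PRIMES AT `2` EXIST — Čebotarev in `ℚ(E[2], μ_m, ½P₀)`, proved in the tree) and gk2-p5's
`…PrimeHeegnerTwinRowOne` (the prime Heegner field `ℚ(√−ℓ)` of a prime `ℓ ≡ 7 (8)`, `ℓ ≡ −1 (p)` for `p ∣ N`). THEOREMS ONLY (no definition,
no named fact, no `sorry`); helper `--supports stmt-BirchSwinnertonDyer-22136`; no item is closed; BSD is not proved by any of this.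

WHAT.
* §13 `exists_kummerMapTorsion_ne_zero_of_rank_one` — rank one ⟹ some rational point has non-zero Kummer class in `H¹(ℚ, E[2])`
  (`#(E(ℚ)/2E(ℚ)) = 2^{rank}·#E(ℚ)[2]`, `ker κ = 2E(ℚ)`); `meetsNonNormAt_of_localization_kummerMapTorsion_ne_zero` — the `Ш`-free
  direction of the Kummer reading for a Kummer class: `loc_q κ(P) ≠ 0 ⟹` the door is open at `q` (Hensel);
* §14 **`transpositionSupplyAtTwo_holds : F1Sign2.SingleDoor.TranspositionSupplyAtTwo`** — for `W/ℚ` globally minimal elliptic with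
  `Δ_W < 0`, `E(ℚ)[2] = 0` (so `ρ̄_{W,2}` is onto: irreducible cubic, non-square discriminant — Dokchitser–Dokchitser, tree
  `hasSurjectiveModNGaloisRep_two_iff`) and rank one: a twisting prime `ℓ ≡ 7 (8)`, `ℓ ≡ −1 (mod p)` for every `p ∣ N_W`, with
  `loc_ℓ κ(P₀) ≠ 0` (LEAD) gives `K = ℚ(√−ℓ)` imaginary quadratic, Heegner for `N_W`, `(d_K, N_W) = 1`, `d_K = −ℓ` transposition-admissible
  at `q₀ = ℓ` (`(Δ/ℓ) = −1` by the LEAD's Jacobi-symbol parity on `Δ < 0`; `(−ℓ/p) = (1/p) = 1` at the bad odd `p`) and the door OPEN at `ℓ`.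

Honest framing: AN-24S is «THEOREM on paper» (REF1 §59 theorem-grade; census ENGINE I 118 243/118 243) — unconditional field arithmetic +
Čebotarev, KNOWN ingredients; it becomes a kernel theorem with no hypothesis; beyond-print theorem: no. Its composition with the CONJECTURE
AN-22K (`exists_oddIndexDatum_of_doorLaw_of_supply`, -an g8) is untouched. No item is closed; crux 22136 OPEN at (U) ∧ (CONV₂); BSD is not proved.

References: [MazurRubin2010] Prop. 3.3, Lemma 3.5; [GrossLMS1991] §9 Prop. 9.6; [Kramer1981] Prop. 3; [DokchitserDokchitserMathZ2012] Thm (1);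
[SilvermanAEC2009] VIII.§2, X.4.2 (a).
-/

set_option linter.dupNamespace false -- tree convention: `Summit.BirchSwinnertonDyer.BirchSwinnertonDyer.Theorems` (summit = sub-problem)
set_option autoImplicit false

noncomputable section

open scoped Classical ContRepresentation

namespace Summit.BirchSwinnertonDyer.BirchSwinnertonDyer.Theorems.GenusKolyTransp

open WeierstrassCurve Field NumberField IsDedekindDomain Function
open Literature.NumberTheory.EllipticCurves Literature.NumberTheory.GaloisRepresentations
open Literature.NumberTheory.GaloisCohomology
open Rat.HeightOneSpectrum (primesEquiv natGenerator)
open Summit.BirchSwinnertonDyer.Rank1Residual.F1Sign2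
open Summit.BirchSwinnertonDyer.Rank1Residual.F1Sign2.EggDoubling (eq_zero_of_two_smul_eq_zero)
open Summit.BirchSwinnertonDyer.Rank1Residual.F1Sign2.TranspositionDoor (TranspAdmissible MeetsNonNormAt)
open Summit.BirchSwinnertonDyer.Rank1Residual.F1Sign2.SingleDoor (TranspositionSupplyAtTwo)
open Summit.BirchSwinnertonDyer.BirchSwinnertonDyer.Theorems.GenusKolyArch (localization_kummerMapTorsion_eq_zero_iff hdiv_two)
open Summit.BirchSwinnertonDyer.BirchSwinnertonDyer.Theorems.GenusKolyTwistingPrime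
  (primesEquiv_eq natCast_not_mem_of_not_dvd exists_twistingPrime_not_mem_strictLocalKer)
open Summit.BirchSwinnertonDyer.BirchSwinnertonDyer.Theorems.GenusKolyTwistLocal (mem_torsionLocalKer_iff_localization_eq_zero_rat)
open Summit.BirchSwinnertonDyer.BirchSwinnertonDyer.Theorems.GenusKolyTwin
  (exists_heegnerField_of_prime exists_prime_dvd_discr_jacobiSym_eq_neg_one_of_Δ_neg)

variable (W : WeierstrassCurve ℚ) [W.IsElliptic]

/-! ## §13 A rational point with non-zero Kummer class; the `Ш`-free door direction -/

/-- **Rank one ⟹ some rational point has non-zero Kummer class `κ₂(P) ∈ H¹(K, E[2])`** (any number field `K`):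
`#(E(K)/2E(K)) = 2^{rank}·#E(K)[2] ≥ 2` (tree `natCard_quotient_range_zsmul_eq_pow_mul_card_torsionBy`, Mordell–Weil), and `ker κ₂ = 2E(K)`
(`kummerMapTorsion_ker`). Stated over a general number field so that the group law on `E(K)` carries one `DecidableEq` instance throughout.
[cite: SilvermanAEC2009, VIII.§2 (Kummer sequence) and VIII.6] -/
theorem exists_kummerMapTorsion_ne_zero_of_rank_one {K : Type} [Field K] [NumberField K] (V : WeierstrassCurve K) [V.IsElliptic]
    (hdiv : ∀ P : geomPoints V, ∃ Q : geomPoints V, ((2 : ℕ) : ℤ) • Q = P) (hrank : V.mordellWeilRank = 1) :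
    ∃ P : V.toAffine.Point, kummerMapTorsion V ((2 : ℕ) : ℤ) hdiv P ≠ 0 := by
  haveI : PerfectField K := PerfectField.ofCharZero
  by_contra h
  push Not at h
  -- every rational point is `2`-divisible
  have htop : (kummerMapTorsion V ((2 : ℕ) : ℤ) hdiv).ker = ⊤ := eq_top_iff.mpr fun P _ ↦ h P
  rw [kummerMapTorsion_ker] at htop
  -- but `#(E(K)/2E(K)) = 2 ^ rank · #E(K)[2]` with rank `1`
  haveI : Module.Finite ℤ V.toAffine.Point := V.module_finite_point_holds
  have hcard := natCard_quotient_range_zsmul_eq_pow_mul_card_torsionBy (A := V.toAffine.Point) 2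
  unfold WeierstrassCurve.mordellWeilRank at hrank
  have h1 : Nat.card (V.toAffine.Point ⧸ (⊤ : AddSubgroup V.toAffine.Point)) = 1 := AddSubgroup.index_top
  rw [hrank, pow_one, htop, h1] at hcard
  omega

/-- **`loc_v κ(P) ≠ 0 ⟹` the door is open at `q`** (`W/ℚ` globally minimal, `q ∤ 2Δ_W`, `v ∋ q`; NO hypothesis on `Ш`): if every rational
point reduced into `2Ẽ(𝔽_q)` then `P ∈ 2E(ℚ_q)` by Hensel (`exists_smul_reducePointAt_iff_exists_smul_padic`) and `loc_v κ(P) = 0`.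
[cite: Kramer1981, Prop. 3] [cite: SilvermanAEC2009, Prop. VII.2.1] -/
theorem meetsNonNormAt_of_localization_kummerMapTorsion_ne_zero [W.IsGloballyMinimal] (v : HeightOneSpectrum (𝓞 ℚ)) {q : ℕ}
    [Fact q.Prime] (hqv : (q : 𝓞 ℚ) ∈ v.asIdeal) (hq2 : q ≠ 2) (hq : ¬ (q : ℤ) ∣ minimalDiscriminantInt W) (P : W.toAffine.Point)
    (h : galoisCohomology.localization (W.torsionGaloisModule ((2 : ℕ) : ℤ)) (Sum.inr v) 1 (kummerMapTorsion W _ (hdiv_two W) P) ≠ 0) :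
    MeetsNonNormAt W q := by
  by_contra hshut
  have h2 : ((2 : ℕ) : ℤ) ≠ 0 := by norm_num
  have hn : ¬ q ∣ 2 := fun h ↦ hq2 ((Nat.prime_dvd_prime_iff_eq (Fact.out) Nat.prime_two).mp h)
  have hdoor : ∃ Q : (reductionAtPrime W q).toAffine.Point, reducePointAt W q P = 2 • Q := by
    by_contra hne
    push Not at hne
    exact hshut ⟨P, hne⟩
  rw [exists_smul_reducePointAt_iff_exists_smul_padic q W hq hn P, ← exists_two_smul_adicCompletion_iff_padic W v hqv] at hdoor
  obtain ⟨R, hR⟩ := hdoor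
  apply h
  rw [localization_kummerMapTorsion_eq_zero_iff W h2 (hdiv_two W)]
  exact ⟨R, by rw [natCast_zsmul]; exact hR⟩

/-! ## §14 AN-24S BY NAME -/

/-- `(−ℓ) mod p = 1` for `p ∣ ℓ + 1`, `p ≥ 2`. [folklore] -/
private theorem neg_emod_eq_one_of_dvd_succ {ℓ p : ℕ} (hp : 2 ≤ p) (h : p ∣ ℓ + 1) : (-(ℓ : ℤ)) % (p : ℤ) = 1 := by
  obtain ⟨k, hk⟩ := h
  have hk' : (-(ℓ : ℤ)) = 1 + (p : ℤ) * (-(k : ℤ)) := by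
    have : ((ℓ : ℤ) + 1) = (p : ℤ) * k := by exact_mod_cast hk
    linarith
  rw [hk', Int.add_mul_emod_self_left]
  exact Int.emod_eq_of_lt (by norm_num) (by exact_mod_cast hp)

omit W in
/-- **AN-24S `F1Sign2.SingleDoor.TranspositionSupplyAtTwo` HOLDS** (census ENGINE I 118 243/118 243): for every globally minimal elliptic `W/ℚ`
with `Δ_W < 0`, `E(ℚ)[2] = 0` and Mordell–Weil rank one there are an imaginary quadratic `K` with `(d_K, N_W) = 1` satisfying the Heegner
hypothesis for `N_W` and a prime `q₀` such that `(d_K, q₀)` is transposition-admissible and the door is OPEN at `q₀`. Witness: a Mazur–Rubin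
twisting prime `ℓ` for the Kummer class of a rational point `P₀ ∉ 2E(ℚ)` (`ℓ ≡ 7 (8)`, `ℓ ≡ −1 (mod p)` for `p ∣ N_W`, `loc_ℓ κ(P₀) ≠ 0` — the
LEAD's `exists_twistingPrime`, Čebotarev proved), `K = ℚ(√−ℓ)`, `q₀ = ℓ`. [cite: MazurRubin2010, Prop. 3.3 and Lemma 3.5]
[cite: GrossLMS1991, §9 Prop. 9.6] [cite: Kramer1981, Prop. 3] -/
theorem transpositionSupplyAtTwo_holds : TranspositionSupplyAtTwo := by
  intro W _ _ _ hΔ hT hrank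
  have hN : W.conductorNorm ℤ ≠ 0 := (W.conductorNorm_pos_holds).ne'
  -- `ρ̄_{W,2}` onto: no rational `2`-torsion, `Δ < 0` not a square
  have hsurj : W.HasSurjectiveModNGaloisRep 2 := by
    refine (hasSurjectiveModNGaloisRep_two_iff W).mpr ⟨fun P hP ↦ ?_, fun ⟨r, hr⟩ ↦ ?_⟩
    · -- (`convert` bridges the two `DecidableEq ℚ` instances behind the group law)
      have h := eq_zero_of_two_smul_eq_zero W hT P
      convert h (by convert hP)
    · exact absurd hΔ (not_lt.mpr (hr ▸ mul_self_nonneg r))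
  -- a rational point with non-zero Kummer class, and a twisting prime for it
  obtain ⟨P₀, hP₀⟩ := exists_kummerMapTorsion_ne_zero_of_rank_one W (hdiv_two W) hrank
  obtain ⟨ℓ, hℓF, -, hℓN, hℓ8, hℓp, hloc⟩ :=
    exists_twistingPrime_not_mem_strictLocalKer W hsurj hΔ (c := kummerMapTorsion W ((2 : ℕ) : ℤ) (hdiv_two W) P₀) hP₀ hN 0
  have hℓ : ℓ.Prime := hℓF.out
  have hℓN' : ∀ p : ℕ, p.Prime → p ∣ W.conductorNorm ℤ → p ≠ 2 → (ℓ : ZMod p) = -1 := by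
    intro p _ hp _
    have h : ((ℓ + 1 : ℕ) : ZMod p) = 0 := (ZMod.natCast_eq_zero_iff _ _).mpr (hℓp p hp)
    rw [Nat.cast_add, Nat.cast_one] at h
    exact eq_neg_of_add_eq_zero_left h
  -- the prime Heegner field `ℚ(√−ℓ)`
  obtain ⟨hℓN'', hℓΔ, K, _, _, hK, hd, hodd, -, hH, -, -, -⟩ := exists_heegnerField_of_prime W hℓ hℓ8 hℓN'
  -- `(Δ/ℓ) = −1`: the unique prime of `d_K = −ℓ` is a transposition prime (`Δ < 0`)
  have hjac : jacobiSym W.Δ.num ℓ = -1 := by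
    obtain ⟨q, hq, -, hqd, -, -, hJ⟩ := exists_prime_dvd_discr_jacobiSym_eq_neg_one_of_Δ_neg W hK hodd hH hΔ
    rw [hd, dvd_neg, Int.natCast_dvd_natCast, Nat.prime_dvd_prime_iff_eq hq hℓ] at hqd
    subst hqd
    rwa [← cast_minimalDiscriminantInt W, Rat.num_intCast]
  -- the place of `ℓ` and the open door
  obtain ⟨v, hv⟩ : ∃ v : HeightOneSpectrum (𝓞 ℚ), (ℓ : 𝓞 ℚ) ∈ v.asIdeal :=
    ⟨primesEquiv.symm ⟨ℓ, hℓ⟩, by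
      have h := Rat.HeightOneSpectrum.natCast_natGenerator_mem (primesEquiv.symm ⟨ℓ, hℓ⟩)
      rwa [show natGenerator (primesEquiv.symm ⟨ℓ, hℓ⟩) = ℓ from
        congrArg Subtype.val (primesEquiv.apply_symm_apply (⟨ℓ, hℓ⟩ : Nat.Primes))] at h⟩
  have hℓ2 : ℓ ≠ 2 := by omega
  have hdoor : MeetsNonNormAt W ℓ := by
    refine meetsNonNormAt_of_localization_kummerMapTorsion_ne_zero W v hv hℓ2 hℓΔ P₀ fun h0 ↦ hloc ?_
    have h1 := (mem_torsionLocalKer_iff_localization_eq_zero_rat W v _).mpr h0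
    obtain hpq := primesEquiv_eq hℓ hv
    subst hpq
    letI : Algebra ℚ (v.adicCompletion ℚ) := inferInstance
    haveI : CharZero (v.adicCompletion ℚ) := charZero_adicCompletion v
    exact (GenusKolyTwistingPrime.mem_torsionLocalKer_padic_iff W
      (RingEquivClass.toRingEquiv (Rat.HeightOneSpectrum.adicCompletion.padicEquiv (R := 𝓞 ℚ) v)) ((2 : ℕ) : ℤ) _).mpr h1
  -- transposition-admissibility of `(−ℓ, ℓ)`
  have hadm : TranspAdmissible W (NumberField.discr K) ℓ := by
    rw [hd]
    refine ⟨by simpa using hℓ.pos, ?_, ?_, hℓ, dvd_neg.mpr (dvd_refl _), hjac, fun q hq hqd ↦ ?_, fun p hp hp2 hbad ↦ ?_⟩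
    · rw [← Int.squarefree_natAbs, Int.natAbs_neg, Int.natAbs_natCast]
      exact hℓ.squarefree
    · omega
    · rw [dvd_neg, Int.natCast_dvd_natCast, Nat.prime_dvd_prime_iff_eq hq hℓ] at hqd
      subst hqd
      refine ⟨fun _ ↦ ?_, fun h ↦ absurd rfl h⟩
      by_contra hng
      exact hℓN'' ((W.dvd_conductorNorm_iff_not_hasGoodReductionAtPrime q).mpr hng)
    · haveI := Fact.mk hp
      have hpN : p ∣ W.conductorNorm ℤ := (W.dvd_conductorNorm_iff_not_hasGoodReductionAtPrime p).mpr (hbad inferInstance)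
      rw [jacobiSym.mod_left, neg_emod_eq_one_of_dvd_succ hp.two_le (hℓp p hpN)]
      exact jacobiSym.one_left p
  have hcop : Nat.Coprime (NumberField.discr K).natAbs (W.conductorNorm ℤ) := by
    rw [hd, Int.natAbs_neg, Int.natAbs_natCast]
    exact (Nat.Prime.coprime_iff_not_dvd hℓ).mpr hℓN''
  exact ⟨K, inferInstance, inferInstance, ℓ, hℓF, hK, hadm, hdoor, hcop, hH⟩

end Summit.BirchSwinnertonDyer.BirchSwinnertonDyer.Theorems.GenusKolyTransp

end
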